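import Summits.CriticalPhenomena.PercolationContinuityZ3.Theorems.PercNearOneGluingNoHeavyQuantSGCNoLowRightLayer
import Summits.CriticalPhenomena.PercolationContinuityZ3.Theorems.PercNearOneGluingNoHeavyQuantSGCLightCells
import Summits.CriticalPhenomena.PercolationContinuityZ3.Theorems.PercNearOneGluingNoHeavyQuantHeavyMixSingleGate
import Summits.CriticalPhenomena.PercolationContinuityZ3.Theorems.PercNearOneGluingNoHeavyQuantLawDecFlowsDecomposition
import Summits.CriticalPhenomena.PercolationContinuityZ3.Theorems.PercNearOneGluingNoHeavyQuantFlowPieces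
import HarnessLib

/-!
# QUANT lane R8, T-DEC, leg (III): **`SingleGateConvClosed` FOR NO-LOW SECOND FACTORS** — the gated product of an admissible law with ANY
# top-affordable law none of whose atoms is low is DEC at every layer

builds on p205010 (kernel theorem, internal audit signed; external expert review pending)

Support file (`--supports stmt-CriticalPhenomena-4575`), QUANT lane seat prim-quant-arm-2 (gen 37), rung R8 of
`run/shared/lean/prim/quant/LADDER.md`.  Theorems only, standard axioms, no sorries.  Memo `run/shared/lean/prim/quant/prim-quant-arm-2-g37/L2-TRANSPORT-G37.md`.

THE THEOREM.  `μ₁` a probability law on `{0..M₁}`, top-affordable (`y·M₁ ≤ q·T₁`), `gate_q μ₁` DEC at every layer `j′ < M₁`; `ν₂` a probability law on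
`{0..M₂}`, top-affordable (`y·M₂ ≤ q·T₂`), with NO LOW ATOM: `ν₂ s > 0 ⟹ q·T₂ ≤ 2s`.  Then `gate_q(μ₁ ∗ ν₂)` is DEC at every layer `j′ < M₁ + M₂`.
No DEC hypothesis on `ν₂` is needed (a no-low top-affordable law is automatically admissible: lead g30's first-moment criterion).  Light admissible
pairs are no-low (`lightPair_two_lo_ge`), so cell L2 `SGCLightPair` (`…QuantSGCLightPairHolds`) is the two-atom case; 73 % of the residue triples of
cell L3 are no-low.  PROOF: `L = gate_q(μ₁ ∗ ν₂) = (1−q)δ₀ + Σ_s ν₂(s)·q μ₁(·−s)` (`gate_lconv_eq_sum_shift`), mass `1`, mean `q(T₁+T₂)`; flows of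
`gate_q μ₁` at EVERY layer (`decAtT_gate_of_allLayers`); `flowAtT_noLow_layer` (typer g26's gated-shift construction run from every present copy
with pooled slots and pooled giant room); `decAtT_of_flowAtT`.  Degenerate factors (`T₁ = 0` or `T₂ = 0`, i.e. `δ₀`) are handled directly.

* `LawDec.lconv_eq_sum_shift` — `(μ₁ ∗ ν₂)(h) = Σ_{s ≤ M₂} ν₂ s·[s ≤ h]·μ₁(h − s)`.
* **`LawDec.sgc_noLow_right`** — the theorem; **`LawDec.sgcLightTriple_of_noLow`** — cell L3 (`SGCLightTriple`) for no-low triples (`2s₁ ≥ qT₂`).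
HONEST STATUS: `SGCLightTriple` with a LOW smallest atom, `WindowMixDEC`, `SingleGateConvClosed`, `TreeBuiltAD3`, `GateMove`, `FarTreeRow` remain
OPEN; the RATE class log\* and the honest sentence of `run/shared/lean/prim/quant/README.md` are unchanged.

[this work]; one-copy construction: typer g26; first-moment criterion: lead g30 (this lane).  The gluing rows served
[cite: KozmaNitzan2024, Conjecture 3 (p. 15)]; product measure [cite: Grimmett1999, §1.3 p. 10].
-/

noncomputable section

namespace Summit.CriticalPhenomena.PercolationContinuityZ3.Theorems

namespace Quant

open Finset

namespace LawDec

/-- **the truncated convolution along the shifts of the second factor**: `(μ₁ ∗ ν₂)(h) = Σ_{s ≤ M₂} ν₂ s·[s ≤ h]·μ₁(h−s)` for `μ₁` vanishing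
above `M₁`. [this work] -/
theorem lconv_eq_sum_shift (M₁ M₂ : ℕ) (μ₁ ν₂ : ℕ → ℝ) (hμM : ∀ h, M₁ < h → μ₁ h = 0) (h : ℕ) :
    lconv M₁ M₂ μ₁ ν₂ h = ∑ s ∈ Finset.range (M₂ + 1), ν₂ s * (if s ≤ h then μ₁ (h - s) else 0) := by
  classical
  simp only [lconv]
  rw [Finset.sum_comm]
  refine Finset.sum_congr rfl fun s _ => ?_
  by_cases hs : s ≤ h
  · rw [if_pos hs]
    by_cases hi : h - s ≤ M₁
    · rw [Finset.sum_eq_single (h - s)]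
      · rw [if_pos (by omega)]; ring
      · intro i _ hi'; rw [if_neg (by omega)]
      · intro hn; exact absurd (Finset.mem_range.2 (by omega)) hn
    · rw [hμM (h - s) (by omega), mul_zero]
      exact Finset.sum_eq_zero fun i hi' => by
        rw [Finset.mem_range] at hi'
        rw [if_neg (by omega)]
  · rw [if_neg hs, mul_zero]
    exact Finset.sum_eq_zero fun i _ => by rw [if_neg (by omega)]

/-- **`SingleGateConvClosed` FOR NO-LOW SECOND FACTORS** (file header). [this work] -/
theorem sgc_noLow_right (y q : ℝ) (M₁ M₂ : ℕ) (μ₁ ν₂ : ℕ → ℝ) (hy0 : 0 < y) (hy1 : y < 1) (hq0 : 0 < q) (hq1 : q ≤ 1)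
    (hμ0 : ∀ h, 0 ≤ μ₁ h) (hμM : ∀ h, M₁ < h → μ₁ h = 0) (hμ1 : ∑ h ∈ Finset.range (M₁ + 1), μ₁ h = 1)
    (hta₁ : y * (M₁ : ℝ) ≤ q * ∑ h ∈ Finset.range (M₁ + 1), (h : ℝ) * μ₁ h)
    (hD₁ : ∀ j', j' < M₁ → DECAt y j' M₁ (gate μ₁ q))
    (hν0 : ∀ s, 0 ≤ ν₂ s) (hνM : ∀ s, M₂ < s → ν₂ s = 0) (hν1 : ∑ s ∈ Finset.range (M₂ + 1), ν₂ s = 1)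
    (hta₂ : y * (M₂ : ℝ) ≤ q * ∑ s ∈ Finset.range (M₂ + 1), (s : ℝ) * ν₂ s)
    (hnolow : ∀ s, 0 < ν₂ s → q * ∑ s ∈ Finset.range (M₂ + 1), (s : ℝ) * ν₂ s ≤ 2 * (s : ℝ)) :
    ∀ j', j' < M₁ + M₂ → DECAt y j' (M₁ + M₂) (gate (lconv M₁ M₂ μ₁ ν₂) q) := by
  intro j' hj'
  classical
  set T₁ : ℝ := ∑ h ∈ Finset.range (M₁ + 1), (h : ℝ) * μ₁ h with hT₁
  set T₂ : ℝ := ∑ s ∈ Finset.range (M₂ + 1), (s : ℝ) * ν₂ s with hT₂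
  set M : ℕ := M₁ + M₂ with hMdef
  set L : ℕ → ℝ := gate (lconv M₁ M₂ μ₁ ν₂) q with hL
  have hT₁nn : 0 ≤ T₁ := Finset.sum_nonneg fun h _ => mul_nonneg (Nat.cast_nonneg h) (hμ0 h)
  have hT₂nn : 0 ≤ T₂ := Finset.sum_nonneg fun s _ => mul_nonneg (Nat.cast_nonneg s) (hν0 s)
  /- ### the law `L` -/
  have hlconv0 : ∀ h, 0 ≤ lconv M₁ M₂ μ₁ ν₂ h := fun h => lconv_nonneg M₁ M₂ _ _ hμ0 hν0 h
  have hlconvM : ∀ h, M < h → lconv M₁ M₂ μ₁ ν₂ h = 0 := fun h hh => lconv_eq_zero M₁ M₂ _ _ h hh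
  have hlconv1 : ∑ h ∈ Finset.range (M + 1), lconv M₁ M₂ μ₁ ν₂ h = 1 := sum_lconv M₁ M₂ _ _ hμ1 hν1
  have hlconvmean : ∑ h ∈ Finset.range (M + 1), (h : ℝ) * lconv M₁ M₂ μ₁ ν₂ h = T₁ + T₂ := by
    rw [hMdef, sum_mul_lconv M₁ M₂ _ _ hμ1 hν1]
  obtain ⟨L0nn, LM, L1⟩ := gate_laws M _ q hq0.le hq1 hlconv0 hlconvM hlconv1
  have Lmean : ∑ h ∈ Finset.range (M + 1), (h : ℝ) * L h = q * (T₁ + T₂) := by rw [hL, sum_mul_gate, hlconvmean]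
  have hLval : ∀ t, L t = q * ∑ s ∈ Finset.range (M₂ + 1), ν₂ s * (if s ≤ t then μ₁ (t - s) else 0)
      + (1 - q) * (if t = 0 then (1 : ℝ) else 0) := by
    intro t; rw [hL, gate_apply, lconv_eq_sum_shift M₁ M₂ μ₁ ν₂ hμM t]
  rw [decAt_iff_decAtT, Lmean]
  by_cases hT₂0 : T₂ = 0
  · /- degenerate second factor `ν₂ = δ₀`: `M₂ = 0` and `L = gate_q μ₁` -/
    have hνpos : ∀ s, 1 ≤ s → ν₂ s = 0 := by
      intro s hs
      by_contra hne
      have hp : 0 < ν₂ s := lt_of_le_of_ne (hν0 s) (Ne.symm hne)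
      have hsM : s ≤ M₂ := by by_contra h; exact hne (hνM s (by omega))
      have : (s : ℝ) * ν₂ s ≤ T₂ := by
        rw [hT₂]
        exact Finset.single_le_sum (f := fun s : ℕ => (s : ℝ) * ν₂ s) (fun (i : ℕ) _ => mul_nonneg (Nat.cast_nonneg i) (hν0 i))
          (Finset.mem_range.2 (by omega))
      have h1 : (1 : ℝ) ≤ s := by exact_mod_cast hs
      nlinarith
    have hM₂0 : M₂ = 0 := by
      by_contra hne
      have : (1 : ℝ) ≤ M₂ := by exact_mod_cast Nat.one_le_iff_ne_zero.2 hne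
      rw [hT₂0] at hta₂; nlinarith
    have hν00 : ν₂ 0 = 1 := by
      have := hν1; rw [hM₂0, Finset.sum_range_one] at this; exact this
    have hLeq : L = gate μ₁ q := by
      funext t
      rw [hLval t, gate_apply, hM₂0, Finset.sum_range_one, hν00, one_mul, if_pos (Nat.zero_le t), Nat.sub_zero]
    have hmean₁ : ∑ h ∈ Finset.range (M₁ + 1), (h : ℝ) * gate μ₁ q h = q * T₁ := by rw [sum_mul_gate]
    have hj'' : j' < M₁ := by rw [hMdef, hM₂0, Nat.add_zero] at hj'; exact hj'
    have h := hD₁ j' hj''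
    rw [decAt_iff_decAtT, hmean₁] at h
    rw [hLeq, hT₂0, add_zero, hMdef, hM₂0, Nat.add_zero]
    exact h
  have hT₂pos : 0 < T₂ := lt_of_le_of_ne hT₂nn (Ne.symm hT₂0)
  have hΔ0 : 0 < q * T₂ := mul_pos hq0 hT₂pos
  have hnolow' : ∀ s, 0 < ν₂ s → q * T₂ ≤ 2 * (s : ℝ) := fun s hs => hnolow s hs
  have hν00 : ν₂ 0 = 0 := by
    rcases (hν0 0).eq_or_lt with hz | hp
    · exact hz.symm
    · have := hnolow' 0 hp; simp at this; linarith
  have hM₂pos : (0 : ℝ) < M₂ := by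
    have hne : M₂ ≠ 0 := by
      intro h0
      have := hν1; rw [h0, Finset.sum_range_one, hν00] at this; exact absurd this (by norm_num)
    exact_mod_cast Nat.pos_of_ne_zero hne
  have hT₂M₂ : T₂ ≤ M₂ := by
    rw [hT₂]
    calc ∑ s ∈ Finset.range (M₂ + 1), (s : ℝ) * ν₂ s ≤ ∑ s ∈ Finset.range (M₂ + 1), (M₂ : ℝ) * ν₂ s :=
          Finset.sum_le_sum fun s hs => mul_le_mul_of_nonneg_right
            (by exact_mod_cast Nat.le_of_lt_succ (Finset.mem_range.1 hs)) (hν0 s)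
      _ = M₂ := by rw [← Finset.mul_sum, hν1, mul_one]
  have hyq : y ≤ q := by
    have h1 : y * (M₂ : ℝ) ≤ q * (M₂ : ℝ) := le_trans hta₂ (by nlinarith)
    exact le_of_mul_le_mul_right h1 hM₂pos
  have hL0 : L 0 = 1 - q := by
    rw [hLval 0]
    have : ∑ s ∈ Finset.range (M₂ + 1), ν₂ s * (if s ≤ 0 then μ₁ (0 - s) else 0) = 0 := by
      refine Finset.sum_eq_zero fun s _ => ?_
      by_cases hs : s = 0
      · rw [hs, hν00, zero_mul]
      · rw [if_neg (by omega), mul_zero]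
    rw [this, if_pos rfl]; ring
  have hLt : ∀ t, 1 ≤ t → L t = ∑ s ∈ Finset.range (M₂ + 1), ν₂ s * (if s ≤ t then q * μ₁ (t - s) else 0) := by
    intro t ht
    rw [hLval t, if_neg (show t ≠ 0 by omega), mul_zero, add_zero, Finset.mul_sum]
    exact Finset.sum_congr rfl fun s _ => by split_ifs <;> ring
  have hta : y * (M : ℝ) ≤ q * T₁ + q * T₂ := by rw [hMdef]; push_cast; linarith
  by_cases hT₁0 : T₁ = 0
  · /- degenerate first factor `μ₁ = δ₀`: `M₁ = 0`, `L = gate_q ν₂`, whose only low is the zero -/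
    have hM₁0 : M₁ = 0 := by
      by_contra hne
      have : (1 : ℝ) ≤ M₁ := by exact_mod_cast Nat.one_le_iff_ne_zero.2 hne
      rw [hT₁0] at hta₁; nlinarith
    have hμpos : ∀ h, 1 ≤ h → μ₁ h = 0 := fun h hh => hμM h (by omega)
    have hμ00 : μ₁ 0 = 1 := by
      have := hμ1; rw [hM₁0, Finset.sum_range_one] at this; exact this
    -- no nonzero low of `L`
    have hlows : ∀ l, 1 ≤ l → l ≤ j' → 2 * (l : ℝ) < q * T₁ + q * T₂ → L l = 0 := by
      intro l hl1 _ h2l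
      rw [hLt l hl1]
      refine Finset.sum_eq_zero fun s _ => ?_
      rcases (hν0 s).eq_or_lt with hz | hp
      · rw [← hz, zero_mul]
      · by_cases hsl : s ≤ l
        · by_cases hsl' : s = l
          · have := hnolow' s hp; rw [hsl'] at this; rw [hT₁0, mul_zero, zero_add] at h2l; linarith
          · rw [if_pos hsl, hμpos (l - s) (by omega)]; ring
        · rw [if_neg hsl, mul_zero]
    have hflow : FlowAtT y (q * T₁ + q * T₂) j' M L :=
      flowAtT_of_moment y _ j' M L hy0 hy1 (by rw [hT₁0, mul_zero, zero_add]; exact hΔ0) L0nn hlows (by linarith)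
        (by rw [L1, mul_one, Lmean]; linarith)
    rw [show q * (T₁ + T₂) = q * T₁ + q * T₂ by ring]
    exact decAtT_of_flowAtT y _ j' M L hy0 hy1 LM L1 hflow
  · have hT₁pos : 0 < T₁ := lt_of_le_of_ne hT₁nn (Ne.symm hT₁0)
    have hS : 0 < q * T₁ := mul_pos hq0 hT₁pos
    have hqx : q * (y / q) = y := mul_div_cancel₀ y (ne_of_gt hq0)
    have hF : ∀ J, FlowAtT y (q * T₁) J M₁ (gate μ₁ q) := by
      intro J
      have h := decAtT_gate_of_allLayers (y / q) q M₁ M₁ J μ₁ (div_pos hy0 hq0) hq0 hq1 (by rw [hqx]; exact hy1) hμ0 hμM hμ1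
        (by rw [div_mul_eq_mul_div, div_le_iff₀ hq0]; linarith) (by rw [hqx]; exact hD₁) le_rfl
      rw [hqx] at h
      exact flowAtT_of_decAtT y _ J M₁ _ hy0 hy1 h
    have hflow := flowAtT_noLow_layer y (q * T₁) (q * T₂) q j' M₁ M₂ M μ₁ L ν₂ hy0 hy1 hq0 hyq hS hΔ0 hν0 hν1 hnolow'
      (by omega) hj' hμ0 hμ1 hF L0nn hL0 hLt L1 (by rw [Lmean]; ring) (by linarith)
    rw [show q * (T₁ + T₂) = q * T₁ + q * T₂ by ring]
    exact decAtT_of_flowAtT y _ j' M L hy0 hy1 LM L1 hflow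

/-- **CELL L3 FOR NO-LOW TRIPLES** (`2·s₁ ≥ q·T₂`, 73 % of the sampled residue triples): in `SGCLightTriple`'s binder, with the extra side
condition that the triple's smallest atom is not low for its own gate, the conclusion of cell L3 holds — by `sgc_noLow_right`; neither the
residue condition nor the triple's own DEC datum is needed. [this work] -/
theorem sgcLightTriple_of_noLow (y q p₁ p₂ p₃ T₂ : ℝ) (M₁ M₂ s₁ s₂ s₃ : ℕ) (μ₁ : ℕ → ℝ)
    (hy0 : 0 < y) (hy1 : y < 1) (hq0 : 0 < q) (hq1 : q ≤ 1)
    (hμ0 : ∀ h, 0 ≤ μ₁ h) (hμM : ∀ h, M₁ < h → μ₁ h = 0) (hμ1 : ∑ h ∈ Finset.range (M₁ + 1), μ₁ h = 1)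
    (hta₁ : y * (M₁ : ℝ) ≤ q * ∑ h ∈ Finset.range (M₁ + 1), (h : ℝ) * μ₁ h)
    (hD₁ : ∀ j', j' < M₁ → DECAt y j' M₁ (gate μ₁ q))
    (hs₁₂ : s₁ < s₂) (hs₂₃ : s₂ < s₃) (hs₃ : s₃ ≤ M₂) (hp₁ : 0 < p₁) (hp₂ : 0 < p₂) (hp₃ : 0 < p₃) (hp : p₁ + p₂ + p₃ = 1)
    (hT₂ : p₁ * (s₁ : ℝ) + p₂ * (s₂ : ℝ) + p₃ * (s₃ : ℝ) = T₂) (hta₂ : y * (M₂ : ℝ) ≤ q * T₂)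
    (hnolow : q * T₂ ≤ 2 * (s₁ : ℝ)) :
    ∀ j', j' < M₁ + M₂ → DECAt y j' (M₁ + M₂)
      (gate (lconv M₁ M₂ μ₁ (fun h => p₁ * (if h = s₁ then (1 : ℝ) else 0) + p₂ * (if h = s₂ then (1 : ℝ) else 0)
        + p₃ * (if h = s₃ then (1 : ℝ) else 0))) q) := by
  classical
  set ν₂ : ℕ → ℝ := fun h => p₁ * (if h = s₁ then (1 : ℝ) else 0) + p₂ * (if h = s₂ then (1 : ℝ) else 0)
    + p₃ * (if h = s₃ then (1 : ℝ) else 0) with hν₂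
  have hs₁M : s₁ ∈ Finset.range (M₂ + 1) := Finset.mem_range.2 (by omega)
  have hs₂M : s₂ ∈ Finset.range (M₂ + 1) := Finset.mem_range.2 (by omega)
  have hs₃M : s₃ ∈ Finset.range (M₂ + 1) := Finset.mem_range.2 (by omega)
  have hν0 : ∀ s, 0 ≤ ν₂ s := fun s => by
    simp only [hν₂]; split_ifs <;> nlinarith
  have hνM : ∀ s, M₂ < s → ν₂ s = 0 := fun s hs => by
    simp only [hν₂]; rw [if_neg (by omega), if_neg (by omega), if_neg (by omega)]; ring
  have hν1 : ∑ s ∈ Finset.range (M₂ + 1), ν₂ s = 1 := by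
    simp only [hν₂]
    rw [Finset.sum_add_distrib, Finset.sum_add_distrib, ← Finset.mul_sum, ← Finset.mul_sum, ← Finset.mul_sum,
      Finset.sum_ite_eq' _ s₁, Finset.sum_ite_eq' _ s₂, Finset.sum_ite_eq' _ s₃, if_pos hs₁M, if_pos hs₂M, if_pos hs₃M]
    linarith
  have hmean : ∑ s ∈ Finset.range (M₂ + 1), (s : ℝ) * ν₂ s = T₂ := by
    have e : ∀ s : ℕ, (s : ℝ) * ν₂ s = p₁ * (if s = s₁ then (s₁ : ℝ) else 0) + p₂ * (if s = s₂ then (s₂ : ℝ) else 0)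
        + p₃ * (if s = s₃ then (s₃ : ℝ) else 0) := by
      intro s
      simp only [hν₂]
      by_cases h1 : s = s₁
      · subst h1; rw [if_pos rfl, if_neg (by omega), if_neg (by omega), if_pos rfl, if_neg (by omega), if_neg (by omega)]; ring
      by_cases h2 : s = s₂
      · subst h2; rw [if_neg h1, if_pos rfl, if_neg (by omega), if_neg h1, if_pos rfl, if_neg (by omega)]; ring
      by_cases h3 : s = s₃
      · subst h3; rw [if_neg h1, if_neg h2, if_pos rfl, if_neg h1, if_neg h2, if_pos rfl]; ring
      · rw [if_neg h1, if_neg h2, if_neg h3, if_neg h1, if_neg h2, if_neg h3]; ring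
    rw [Finset.sum_congr rfl fun s _ => e s, Finset.sum_add_distrib, Finset.sum_add_distrib, ← Finset.mul_sum, ← Finset.mul_sum,
      ← Finset.mul_sum, Finset.sum_ite_eq' _ s₁, Finset.sum_ite_eq' _ s₂, Finset.sum_ite_eq' _ s₃, if_pos hs₁M, if_pos hs₂M, if_pos hs₃M]
    exact hT₂
  refine sgc_noLow_right y q M₁ M₂ μ₁ ν₂ hy0 hy1 hq0 hq1 hμ0 hμM hμ1 hta₁ hD₁ hν0 hνM hν1 (by rw [hmean]; exact hta₂) ?_
  intro s hs
  rw [hmean]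
  have hss₁ : s₁ ≤ s := by
    by_contra hlt
    have : ν₂ s = 0 := by
      simp only [hν₂]; rw [if_neg (by omega), if_neg (by omega), if_neg (by omega)]; ring
    rw [this] at hs; exact lt_irrefl _ hs
  have : (s₁ : ℝ) ≤ s := by exact_mod_cast hss₁
  linarith

end LawDec

end Quant

end Summit.CriticalPhenomena.PercolationContinuityZ3.Theorems
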